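import Literature.NumberTheory.GaloisRepresentations.InfResTwo
import Literature.NumberTheory.GaloisRepresentations.CyclicLayerSurjective
import HarnessLib

/-!
# Inflation–restriction in degree two, full form: `0 → H²(G/N, A^N) → H²(G, A) → H²(N, A)` is exact

For a profinite group `G`, a closed normal subgroup `N` and a discrete `G`-module `A` with
`H¹(N, A) = 0`, the sequence `0 → H²(G/N, A^N) →(inf) H²(G, A) →(res) H²(N, A)` is exact
(Serre, *Cohomologie galoisienne*, I §2.6 (b): "si `H^i(H, A) = 0` pour `1 ≤ i < q` … la suite
`0 → H^q(G/H, A^H) → H^q(G, A) → H^q(H, A)` est exacte", `q = 2`; Neukirch–Schmidt–Wingberg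
(1.6.7); Shatz II §4 (25)).  The tree's `InfResTwo.lean` proves only the VANISHING form
(`exists_d_eq_of_res_eq_d_two`: under `H²(G/N, A^N) = 0`, a `2`-cocycle dying on `N` is a
coboundary).  This file proves the statement itself, on Mathlib's continuous cohomology, for the
maps `inf = ContinuousCohomology.map (G → G/N) (A^N ⊆ A) 2` (`invariantsInclusion`) and
`res = resH N A 2`:

* `IsSES.inf_δ₁` — **naturality of the connecting homomorphism under inflation**: for a short exact
  sequence `0 → M₁ → M₂ → M₃ → 0` of discrete `G`-modules whose invariants
  `0 → M₁^N → M₂^N → M₃^N → 0` are again short exact, `inf ∘ δ₁ = δ₁ ∘ inf` (on explicit lifts: the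
  inflation of a lift is a lift of the inflation); the twin of the tree's `IsSES.res_δ₁`;
* `inf_two_injective` — **`inf : H²(G/N, A^N) → H²(G, A)` is injective** when `H¹(N, A) = 0`;
* `exact_inf_res_two` — **`Function.Exact inf res` in degree two** when `H¹(N, A) = 0`, and the
  one-class corollary `exists_inf_two_eq_of_resH_eq_zero`.

Proof: dimension shift through the coinduced module `I = C(G, A)` (`isSES_coind`), which is
`G`-acyclic, `N`-acyclic and has `G/N`-acyclic invariants (`subsingleton_coind`,
`subsingleton_coind_restrict`, `subsingleton_coind_invariants`), with quotient `Q`; the invariants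
`0 → A^N → I^N → Q^N → 0` are short exact because `H¹(N, A) = 0` (`isSES_invariants`).  Then
`H²(G, A) = δ₁ H¹(G, Q)`, `H²(G/N, A^N) = δ₁ H¹(G/N, Q^N)`, `δ₁ : H¹(N, Q) → H²(N, A)` is injective,
and the two naturalities `inf ∘ δ₁ = δ₁ ∘ inf`, `res ∘ δ₁ = δ₁ ∘ res` reduce both statements to
inflation–restriction in degree ONE for `Q` (`exact_inf_res_one_discrete`,
`ContinuousCohomology.inf_one_injective`) — no cochain chase.

Consumers (abc-iut cell, by name): [AbsAnab] Prop 1.2.1 (vii) row L04 `InfUnramifiedBijective`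
(`Inf : H²(G_K/I_K, (K̄ˣ)^{I_K}) → H²(G_K, K̄ˣ)`, with `H¹(I_K, K̄ˣ) = 0` by Hilbert 90), [AbsTopIII]
Prop 3.2 (i) row P32.i.L02 `inflUnr`, [FrdII] Thm 2.4 (ii) row L19 `UnramifiedInflation`.  HONEST
FRAMING: textbook Galois cohomology; nothing here bears on abc or takes a side on [IUTchIII] Cor. 3.12.

## References
* J.-P. Serre, *Cohomologie galoisienne* (1994) / *Galois Cohomology* (1997), I §2.6 (b).
  [SerreGaloisCohomology1997]
* J. Neukirch, A. Schmidt, K. Wingberg, *Cohomology of Number Fields* (2008), (1.6.7).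
  [NeukirchSchmidtWingberg2008]
* S. S. Shatz, *Profinite groups, arithmetic, and geometry* (1972), Ch. II §4 (24)–(25). [Shatz1972]
-/

noncomputable section

open CategoryTheory Topology Function

universe u

namespace Literature.NumberTheory.GaloisRepresentations

open _root_.TopRep _root_.ContRepresentation _root_.ContinuousCohomology

/-! ### Naturality of `δ₁` under inflation -/

section InfNaturality

variable {k : Type*} [CommRing k] [TopologicalSpace k]
variable {G : Type u} [Group G] [TopologicalSpace G] [IsTopologicalGroup G] [CompactSpace G]
variable (N : Subgroup G) [N.Normal]
variable {M₁ : Type u} [AddCommGroup M₁] [Module k M₁] [TopologicalSpace M₁] [DiscreteTopology M₁]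
  [ContinuousSMul k M₁]
variable {M₂ : Type u} [AddCommGroup M₂] [Module k M₂] [TopologicalSpace M₂] [DiscreteTopology M₂]
  [ContinuousSMul k M₂]
variable {M₃ : Type u} [AddCommGroup M₃] [Module k M₃] [TopologicalSpace M₃] [DiscreteTopology M₃]
  [ContinuousSMul k M₃]
variable {ρ₁ : ContinuousRep G k M₁} {ρ₂ : ContinuousRep G k M₂} {ρ₃ : ContinuousRep G k M₃}
variable {f : ρ₁.toTopRep ⟶ ρ₂.toTopRep} {g : ρ₂.toTopRep ⟶ ρ₃.toTopRep}

/-- **Naturality of `δ₁` under inflation**: for a short exact sequence `0 → M₁ → M₂ → M₃ → 0` of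
discrete `G`-modules whose `N`-invariants `0 → M₁^N → M₂^N → M₃^N → 0` are short exact,
`inf (δ₁ z) = δ₁ (inf z)` for every `z ∈ H¹(G/N, M₃^N)` — on cocycles: the inflation `σ ↦ φ̃(σ̄)` of
a lift `φ̃ : G/N → M₂^N` of `φ` is a lift of the inflation of `φ`, and the two connecting cocycles
agree. [cite: SerreGaloisCohomology1997, I §2.6] -/
theorem IsSES.inf_δ₁ (h : IsSES f g)
    (hinv : IsSES (ContinuousRep.invariantsHom (N := N) f) (ContinuousRep.invariantsHom (N := N) g))
    (z : continuousCohomology 1 (ρ₃.quotientInvariants N).toTopRep) :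
    ContinuousCohomology.map (ContinuousMonoidHom.quotientMk N) (invariantsInclusion N ρ₁) 2
        (hinv.δ₁ z) =
      h.δ₁ (ContinuousCohomology.map (ContinuousMonoidHom.quotientMk N) (invariantsInclusion N ρ₃) 1 z) := by
  obtain ⟨φ, rfl⟩ := oneCocycleClass_surjective _ z
  rw [IsSES.δ₁_oneCocycleClass_eq_δ₁Aux, IsSES.δ₁Aux, map_twoCocycleClass, map_oneCocycleClass]
  -- the inflated lift
  let θ : G →ₜ* G ⧸ N := ContinuousMonoidHom.quotientMk N
  let φt : C(G, M₂) :=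
    ⟨fun σ => (hinv.liftCocycle φ (θ σ) : M₂),
      continuous_subtype_val.comp ((hinv.liftCocycle φ).continuous.comp (map_continuous θ))⟩
  have hφt_apply : ∀ σ, φt σ = (hinv.liftCocycle φ (θ σ) : M₂) := fun _ => rfl
  have hval : ∀ σ, g.hom (φt σ) = (φ.1 (θ σ) : M₃) := fun σ =>
    congrArg Subtype.val (hinv.g_liftCocycle_apply φ (θ σ))
  have hφt : ∀ σ τ, g.hom (φt (σ * τ)) = g.hom (φt σ) + ρ₃ σ (g.hom (φt τ)) := fun σ τ => by
    rw [hval, hval, hval, map_mul]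
    exact congrArg Subtype.val (φ.2 (θ σ) (θ τ))
  have e : contOneCocycles.pullback θ (invariantsInclusion N ρ₃) φ = IsSES.pushCocycle φt hφt :=
    Subtype.ext (ContinuousMap.ext fun σ => by
      rw [contOneCocycles.pullback_apply, IsSES.pushCocycle_apply, invariantsInclusion_hom_apply, hval])
  rw [e, IsSES.δ₁_oneCocycleClass]
  refine congrArg _ (Subtype.ext (ContinuousMap.ext fun q => ?_))
  obtain ⟨σ, τ⟩ := q
  apply h.injective
  rw [h.f_connectingCocycle_apply, contTwoCocycles.pullback_apply, invariantsInclusion_hom_apply]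
  have e2 := congrArg Subtype.val
    (hinv.f_connectingCocycle_apply (hinv.liftCocycle φ) (hinv.liftCocycle_isLift φ) (θ σ) (θ τ))
  change (((ContinuousRep.invariantsHom (N := N) f).hom
      ((hinv.connectingCocycle (hinv.liftCocycle φ) (hinv.liftCocycle_isLift φ)).1 (θ σ, θ τ)) :
        ρ₂.invariantsOf N) : M₂) = ρ₂ σ (φt τ) - φt (σ * τ) + φt σ
  rw [e2, hφt_apply, hφt_apply, hφt_apply, map_mul θ σ τ, Submodule.coe_add, Submodule.coe_sub]
  rfl

end InfNaturality

/-! ### Inflation–restriction in degree two -/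

section InfResTwoExact

variable {G : Type u} [Group G] [TopologicalSpace G] [IsTopologicalGroup G] [CompactSpace G]
  [T2Space G] [TotallyDisconnectedSpace G]
variable (N : Subgroup G) [N.Normal] [hN : IsClosed (N : Set G)]
variable {M : Type u} [AddCommGroup M] [TopologicalSpace M] [DiscreteTopology M]
variable (ρ : ContinuousRep G ℤ M)

omit [CompactSpace G] [T2Space G] [TotallyDisconnectedSpace G] hN in
/-- Inflation in degree one is injective, in the `invariantsInclusion` form of `InfResTwo.lean`
(an instance of `ContinuousCohomology.inf_one_injective`). [cite: SerreGaloisCohomology1997, I §2.6 (b)] -/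
theorem inf_one_injective_discrete {k : Type*} [CommRing k] [TopologicalSpace k] {B : Type u}
    [AddCommGroup B] [Module k B] [TopologicalSpace B] [DiscreteTopology B] [ContinuousSMul k B]
    (τ : ContinuousRep G k B) :
    Injective (ContinuousCohomology.map (ContinuousMonoidHom.quotientMk N)
      (invariantsInclusion N τ) 1).hom :=
  ContinuousCohomology.inf_one_injective (S := N) (invariantsInclusion N τ) Subtype.val_injective
    fun m hm => ⟨⟨m, fun n => hm n n.2⟩, rfl⟩

/-- **Inflation in degree two is injective when `H¹(N, A) = 0`**: the map
`inf : H²(G/N, A^N) → H²(G, A)` of Mathlib's continuous cohomology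
(`ContinuousCohomology.map (G → G/N) (A^N ⊆ A) 2`) is injective for a closed normal subgroup `N` of
a profinite group `G` and a discrete `G`-module `A` with `H¹(N, A) = 0` (Serre I §2.6 (b), `q = 2`:
the first arrow of `0 → H²(G/N, A^N) → H²(G, A) → H²(N, A)`).  Dimension shift:
`H²(G/N, A^N) = δ₁ H¹(G/N, Q^N)`, `inf ∘ δ₁ = δ₁ ∘ inf`, `ker δ₁ = im H¹(G, C(G,A)) = 0`, and
inflation in degree one is injective. [cite: SerreGaloisCohomology1997, I §2.6 (b)]
[cite: NeukirchSchmidtWingberg2008, (1.6.7)] -/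
theorem inf_two_injective
    (h1 : Subsingleton (continuousCohomology 1 (ρ.restrict (subgroupIncl N)).toTopRep)) :
    Injective (ContinuousCohomology.map (ContinuousMonoidHom.quotientMk N)
      (invariantsInclusion N ρ) 2).hom := by
  have hS : IsSES ρ.coindι ρ.coindπ := isSES_coind ρ
  have hI := isSES_invariants N ρ h1
  haveI := subsingleton_coind_invariants N ρ 1
  haveI := subsingleton_coind ρ 0
  refine (injective_iff_map_eq_zero _).2 fun w hw => ?_
  obtain ⟨z, rfl⟩ := hI.exists_δ₁_eq_of_map_two_eq_zero w (Subsingleton.elim _ _)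
  have hw' : hS.δ₁ (ContinuousCohomology.map (ContinuousMonoidHom.quotientMk N)
      (invariantsInclusion N ρ.coindQuot) 1 z) = 0 := by
    rw [← hS.inf_δ₁ N hI z]
    exact hw
  obtain ⟨y, hy⟩ := hS.exists_map_one_eq_of_δ₁_eq_zero _ hw'
  have hz : (ContinuousCohomology.map (ContinuousMonoidHom.quotientMk N)
      (invariantsInclusion N ρ.coindQuot) 1).hom z = 0 := by
    change ContinuousCohomology.map (ContinuousMonoidHom.quotientMk N)
      (invariantsInclusion N ρ.coindQuot) 1 z = 0
    rw [← hy, Subsingleton.elim y 0, map_zero]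
  have hz0 : z = 0 := (injective_iff_map_eq_zero _).1 (inf_one_injective_discrete N ρ.coindQuot) z hz
  rw [hz0]
  exact map_zero hI.δ₁

/-- **Inflation–restriction in degree two** (Serre I §2.6 (b), `q = 2`; Hochschild–Serre /
NSW (1.6.7)): for a closed normal subgroup `N` of a profinite group `G` and a discrete `G`-module
`A` with `H¹(N, A) = 0`, the sequence `H²(G/N, A^N) →(inf) H²(G, A) →(res) H²(N, A)` is exact at
`H²(G, A)` (`inf = ContinuousCohomology.map (G → G/N) (A^N ⊆ A) 2`, `res = resH N A 2`); together
with `inf_two_injective`, `0 → H²(G/N, A^N) → H²(G, A) → H²(N, A)` is exact.  Dimension shift: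
`H²(G, A) = δ₁ H¹(G, Q)`, `res ∘ δ₁ = δ₁ ∘ res` (`IsSES.res_δ₁`) with `δ₁ : H¹(N, Q) → H²(N, A)`
injective (`H¹(N, C(G,A)) = 0`), inflation–restriction in degree one for `Q`, and
`inf ∘ δ₁ = δ₁ ∘ inf` (`IsSES.inf_δ₁`). [cite: SerreGaloisCohomology1997, I §2.6 (b)]
[cite: NeukirchSchmidtWingberg2008, (1.6.7)] -/
theorem exact_inf_res_two
    (h1 : Subsingleton (continuousCohomology 1 (ρ.restrict (subgroupIncl N)).toTopRep)) :
    Function.Exact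
      (ContinuousCohomology.map (ContinuousMonoidHom.quotientMk N) (invariantsInclusion N ρ) 2).hom
      (resH N ρ 2).hom := by
  have hS : IsSES ρ.coindι ρ.coindπ := isSES_coind ρ
  have hI := isSES_invariants N ρ h1
  haveI : CompactSpace N := isCompact_iff_compactSpace.mp hN.isCompact
  haveI := subsingleton_coind_invariants N ρ 1
  haveI := subsingleton_coind ρ 1
  haveI := subsingleton_coind_restrict N ρ 0
  -- inflation–restriction in degree one for `Q`
  have hQ := exact_inf_res_one_discrete N ρ.coindQuot
  intro x
  constructor
  · -- `ker res ⊆ im inf`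
    intro hx
    obtain ⟨y, rfl⟩ := hS.exists_δ₁_eq_of_map_two_eq_zero x (Subsingleton.elim _ _)
    -- `res y` dies under the injective `δ₁ : H¹(N, Q) → H²(N, A)`, hence vanishes
    have hres : (hS.res N).δ₁ (resH N ρ.coindQuot 1 y) = 0 := by
      rw [← hS.res_δ₁ N y]
      exact hx
    obtain ⟨v, hv⟩ := (hS.res N).exists_map_one_eq_of_δ₁_eq_zero _ hres
    have hy0 : (resH N ρ.coindQuot 1).hom y = 0 := by
      change resH N ρ.coindQuot 1 y = 0
      rw [← hv, Subsingleton.elim v 0, map_zero]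
    -- so `y` is inflated, and `δ₁` of the inflated class is inflated
    obtain ⟨z, hz⟩ := (hQ y).1 hy0
    refine ⟨hI.δ₁ z, ?_⟩
    change ContinuousCohomology.map (ContinuousMonoidHom.quotientMk N) (invariantsInclusion N ρ) 2
      (hI.δ₁ z) = hS.δ₁ y
    rw [hS.inf_δ₁ N hI z]
    exact congrArg hS.δ₁ hz
  · -- `res ∘ inf = 0`
    rintro ⟨w, rfl⟩
    obtain ⟨z, rfl⟩ := hI.exists_δ₁_eq_of_map_two_eq_zero w (Subsingleton.elim _ _)
    change resH N ρ 2 (ContinuousCohomology.map (ContinuousMonoidHom.quotientMk N)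
      (invariantsInclusion N ρ) 2 (hI.δ₁ z)) = 0
    rw [hS.inf_δ₁ N hI z, hS.res_δ₁ N]
    have h0 : resH N ρ.coindQuot 1 (ContinuousCohomology.map (ContinuousMonoidHom.quotientMk N)
        (invariantsInclusion N ρ.coindQuot) 1 z) = 0 := (hQ _).2 ⟨z, rfl⟩
    rw [h0, map_zero]

/-- **Inflation–restriction in degree two, one class**: if `H¹(N, A) = 0`, a class of `H²(G, A)`
whose restriction to `N` vanishes is inflated from `H²(G/N, A^N)` ("every element of `Br(K)` split
by `K^unr` comes from `H²(Gal(K^unr/K), (K^unr)ˣ)`" is the case `G = G_K`, `N = I_K`, `A = K̄ˣ`).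
[cite: SerreGaloisCohomology1997, I §2.6 (b)] -/
theorem exists_inf_two_eq_of_resH_eq_zero
    (h1 : Subsingleton (continuousCohomology 1 (ρ.restrict (subgroupIncl N)).toTopRep))
    (x : continuousCohomology 2 ρ.toTopRep) (hx : resH N ρ 2 x = 0) :
    ∃ w : continuousCohomology 2 (ρ.quotientInvariants N).toTopRep,
      ContinuousCohomology.map (ContinuousMonoidHom.quotientMk N) (invariantsInclusion N ρ) 2 w = x :=
  ((exact_inf_res_two N ρ h1) x).1 hx

end InfResTwoExact

end Literature.NumberTheory.GaloisRepresentations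

end
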